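import Summits.ResolutionOfSingularities.ResolutionOfSingularities.Theorems.FrobeniusLadderFRationalResolutionStratumDescentGradeZero
import HarnessLib

/-!
# Crux `FrobeniusLadder.FRationalResolution` (stmt-ResolutionOfSingularities-15317), line `redirect`,
# stub `stub_diagonalizableQuotientResolution` — interfaces of the stratum/model comparison needed by
# the DIMENSION half (Kato (2.1)(ii)) of the packaging step (memo MEMO-15317-leafhand2-g3 §6–§7)

`…StratumDescentPrime` / `…StratumDescentGradeZero` only exported REGULARITY statements; the
dimension count of Kato's condition (ii) needs the same comparisons as data-free facts about
`ringKrullDim`, i.e. (1) flatness of `L/(x_I)L` over `R₀/J` for an ABSTRACT model `R₀` of `(S₀)_e`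
(to feed `…IntegralHeight.ringKrullDim_atPrime_eq_of_flat_of_isIntegral`), and (2) the isomorphism
`S_𝔔'/(x_I)S_𝔔' ≅ (L/(x_I)L)_{𝔓̄}` as a `Nonempty` statement with its `ringKrullDim` corollary.

* **`flat_stratum_quotient_model`** — `Module.Flat (R₀ ⧸ J) (L ⧸ (x_I)L)`, `J = (x_I)L ∩ R₀`;
* **`nonempty_ringEquiv_stratum`**, `ringKrullDim_stratum_eq` — `S_𝔔' ⧸ (x_I) ≅ (L/(x_I)L)_{𝔓̄}`,
  `𝔓 = 𝔔'L`, `e ∉ 𝔔'`, and equality of Krull dimensions.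

Honest label: interface brick (no stub closed). No definitions, no named facts, no sorry.
[folklore; cite: SGA3, Exp. VIII §4–5] [folklore; cite: Kato1994, Prop. (7.1)]
-/

noncomputable section

-- single-problem summit: the doubled namespace component is forced
set_option linter.dupNamespace false

open DirectSum Literature.RingTheory.GradedAlgebra
open Literature.AlgebraicGeometry.Resolution.DiagonalizableQuotient

namespace Summit.ResolutionOfSingularities.ResolutionOfSingularities.Theorems.FRationalResolution.StratumModelInterfaces

universe u w

variable {k : Type u} [Field k] {A : Type w} [DecidableEq A] [AddCommGroup A] {S : Type u}
  [CommRing S] [Algebra k S] (𝒮 : A → Submodule k S) [GradedAlgebra 𝒮]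
  {n : ℕ} (x : Fin n → S) (a : Fin n → A) (hx : ∀ i, x i ∈ 𝒮 (a i))

include hx in
/-- **Flatness of the stratum quotient over an abstract model of the degree-zero localization.**
Same data as `…StratumDescentPrime.isRegularLocalRing_quotient_atPrime_of_stratum`.
[folklore; cite: SGA3, Exp. VIII §4–5] -/
theorem flat_stratum_quotient_model (I : Finset (Fin n)) (g : 𝒮 0)
    (hgen : ∀ s : S, (g : S) * s ∈ Algebra.adjoin (𝒮 0) (Set.range x)) (e : 𝒮 0)
    (hge : (g : S) ∣ (e : S)) (hxe : ∀ j ∉ I, x j ∣ (e : S))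
    (L : Type u) [CommRing L] [Algebra S L] [Algebra k L] [IsScalarTower k S L]
    [IsLocalization (Submonoid.powers (e : S)) L]
    (R₀ : Type u) [CommRing R₀] [Algebra (𝒮 0) R₀] [IsLocalization.Away e R₀] [Algebra R₀ L]
    (hcomm : ∀ c : 𝒮 0, algebraMap R₀ L (algebraMap (𝒮 0) R₀ c) = algebraMap S L (c : S)) :
    Module.Flat (R₀ ⧸ ((Ideal.span (x '' (↑I : Set (Fin n)))).map (algebraMap S L)).comap
        (algebraMap R₀ L))
      (L ⧸ (Ideal.span (x '' (↑I : Set (Fin n)))).map (algebraMap S L)) := by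
  classical
  set T : Submonoid S := Submonoid.powers (e : S) with hTdef
  have hT : ∀ t ∈ T, t ∈ 𝒮 0 := StratumDescent.powers_le_gradeZero 𝒮 e
  let ℒ := locPiece 𝒮 T hT L
  letI : GradedAlgebra ℒ := (nonempty_gradedAlgebra_locPiece 𝒮 T hT L).some
  set IS : Ideal S := Ideal.span (x '' (↑I : Set (Fin n))) with hIS
  set IL : Ideal L := IS.map (algebraMap S L) with hIL
  have hIhom : IL.IsHomogeneous ℒ := by
    have h : IL = Ideal.span (algebraMap S L '' (x '' (↑I : Set (Fin n)))) := by
      rw [hIL, hIS, Ideal.map_span]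
    rw [h]
    refine Ideal.homogeneous_span ℒ _ ?_
    rintro _ ⟨_, ⟨i, -, rfl⟩, rfl⟩
    exact ⟨a i, algebraMap_mem_locPiece hT (hx i)⟩
  have heunit : IsUnit (algebraMap S L (e : S)) := IsLocalization.Away.algebraMap_isUnit (e : S)
  have hgunit : IsUnit (algebraMap S L (g : S)) :=
    isUnit_of_dvd_unit (map_dvd (algebraMap S L) hge) heunit
  have hxunit : ∀ j ∉ I, IsUnit (algebraMap S L (x j)) := fun j hj =>
    isUnit_of_dvd_unit (map_dvd (algebraMap S L) (hxe j hj)) heunit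
  let D : Set A := {c | ∃ m : Fin n → ℕ, (∀ i ∈ I, m i = 0) ∧ ∑ i, m i • a i = c}
  have hD : ∀ c ∈ D, ∃ m : Fin n → ℕ, (∀ i ∈ I, m i = 0) ∧ ∑ i, m i • a i = c := fun c hc => hc
  choose m hmI hmdeg using hD
  let u : A → L := fun c => if hc : c ∈ D then algebraMap S L (∏ i, x i ^ m c hc i) else 0
  have hu : ∀ c ∈ D, u c ∈ ℒ c := by
    intro c hc
    simp only [u, dif_pos hc]
    have h := SetLike.prod_pow_mem_graded 𝒮 (F := Finset.univ) (i := a) (g := x) (m c hc)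
      fun i _ => hx i
    rw [hmdeg c hc] at h
    exact algebraMap_mem_locPiece hT h
  have hunit : ∀ c ∈ D, IsUnit (u c) := by
    intro c hc
    simp only [u, dif_pos hc, map_prod, map_pow]
    refine IsUnit.prod_univ_iff.mpr fun i => ?_
    by_cases hi : i ∈ I
    · rw [hmI c hc i hi, pow_zero]; exact isUnit_one
    · exact (hxunit i hi).pow _
  have hzero : ∀ c ∉ D, (ℒ c : Set L) ⊆ IL := by
    intro c hc y hy
    obtain ⟨t, ht, s, hs, hty⟩ := (mem_locPiece_iff hT).mp hy
    have hgs : (g : S) * s ∈ IS :=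
      OffSupportDegrees.mul_mem_span_of_degree_not_mem 𝒮 x a hx I g hgen c hc s hs
    have hgsL : algebraMap S L ((g : S) * s) ∈ IL := Ideal.mem_map_of_mem _ hgs
    obtain ⟨w, hw⟩ := (hgunit.mul (IsLocalization.map_units L ⟨t, ht⟩)).exists_left_inv
    have hy' : y = w * algebraMap S L ((g : S) * s) := by
      calc y = w * (algebraMap S L (g : S) * algebraMap S L t) * y := by
              rw [show algebraMap S L (↑(⟨t, ht⟩ : T)) = algebraMap S L t from rfl] at hw
              rw [hw, one_mul]
        _ = w * algebraMap S L ((g : S) * s) := by rw [map_mul, ← hty]; ring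
    rw [SetLike.mem_coe, hy']
    exact IL.mul_mem_left w hgsL
  have h0 : ∀ r : R₀, algebraMap R₀ L r ∈ ℒ 0 := fun r =>
    StratumDescentPrime.algebraMap_mem_locPiece_zero 𝒮 e L R₀ hcomm r
  have hsurj : ∀ s ∈ ℒ 0, ∃ r : R₀, algebraMap R₀ L r = s := fun s hs =>
    StratumDescentPrime.exists_eq_algebraMap_of_mem_locPiece_zero 𝒮 e L R₀ hcomm hs
  exact GradedQuotientFree.flat_quotient ℒ h0 hsurj IL hIhom D u hu hunit hzero

/-- **`S_𝔔' ⧸ (x_I)S_𝔔' ≅ (L/(x_I)L)_{𝔓̄}`** for `L` a localization of `S` at the powers of `e ∉ 𝔔'`,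
`𝔓 = 𝔔'L ⊇ (x_I)L`. [folklore] -/
theorem nonempty_ringEquiv_stratum {e : S} (I : Finset (Fin n))
    (L : Type u) [CommRing L] [Algebra S L] [IsLocalization (Submonoid.powers e) L]
    (𝔔' : Ideal S) [𝔔'.IsPrime] (he𝔔 : e ∉ 𝔔')
    [h𝔓 : (𝔔'.map (algebraMap S L)).IsPrime]
    (hI𝔓 : (Ideal.span (x '' (↑I : Set (Fin n)))).map (algebraMap S L) ≤ 𝔔'.map (algebraMap S L)) :
    haveI : ((𝔔'.map (algebraMap S L)).map (Ideal.Quotient.mk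
        ((Ideal.span (x '' (↑I : Set (Fin n)))).map (algebraMap S L)))).IsPrime :=
      Ideal.isPrime_map_quotientMk_of_isPrime hI𝔓
    Nonempty ((Localization.AtPrime 𝔔' ⧸ (Ideal.span (x '' (↑I : Set (Fin n)))).map
        (algebraMap S (Localization.AtPrime 𝔔'))) ≃+*
      Localization.AtPrime ((𝔔'.map (algebraMap S L)).map (Ideal.Quotient.mk
        ((Ideal.span (x '' (↑I : Set (Fin n)))).map (algebraMap S L))))) := by
  classical
  set IS : Ideal S := Ideal.span (x '' (↑I : Set (Fin n))) with hIS
  set IL : Ideal L := IS.map (algebraMap S L) with hIL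
  set 𝔓 : Ideal L := 𝔔'.map (algebraMap S L) with h𝔓def
  haveI : (𝔓.map (Ideal.Quotient.mk IL)).IsPrime := Ideal.isPrime_map_quotientMk_of_isPrime hI𝔓
  have hdisj : Disjoint (↑(Submonoid.powers e) : Set S) (𝔔' : Set S) := by
    rw [Set.disjoint_left]
    rintro _ ⟨m, rfl⟩ hm
    exact he𝔔 (‹𝔔'.IsPrime›.mem_of_pow_mem m hm)
  have h𝔔𝔓 : 𝔔' = 𝔓.comap (algebraMap S L) := by
    rw [h𝔓def, ← Ideal.under_def,
      IsLocalization.under_map_of_isPrime_disjoint (Submonoid.powers e) L ‹𝔔'.IsPrime› hdisj]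
  haveI : IsLocalization.AtPrime (Localization.AtPrime 𝔓) (𝔓.comap (algebraMap S L)) :=
    IsLocalization.isLocalization_isLocalization_atPrime_isLocalization
      (Submonoid.powers e) (Localization.AtPrime 𝔓) 𝔓
  have hM : 𝔔'.primeCompl = (𝔓.comap (algebraMap S L)).primeCompl := by
    ext r
    change r ∉ 𝔔' ↔ r ∉ 𝔓.comap (algebraMap S L)
    rw [← h𝔔𝔓]
  haveI : IsLocalization.AtPrime (Localization.AtPrime 𝔓) 𝔔' := by
    change IsLocalization 𝔔'.primeCompl (Localization.AtPrime 𝔓)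
    rw [hM]
    infer_instance
  let ψ : Localization.AtPrime 𝔔' ≃ₐ[S] Localization.AtPrime 𝔓 :=
    IsLocalization.algEquiv 𝔔'.primeCompl _ _
  have hideal : IL.map (algebraMap L (Localization.AtPrime 𝔓)) =
      (IS.map (algebraMap S (Localization.AtPrime 𝔔'))).map
        (ψ : Localization.AtPrime 𝔔' →+* Localization.AtPrime 𝔓) := by
    rw [hIL, Ideal.map_map, Ideal.map_map, ← IsScalarTower.algebraMap_eq]
    congr 1
    ext r
    simp
  let θ₁ := Ideal.quotientEquiv (IS.map (algebraMap S (Localization.AtPrime 𝔔')))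
    (IL.map (algebraMap L (Localization.AtPrime 𝔓)))
    (ψ : Localization.AtPrime 𝔔' ≃+* Localization.AtPrime 𝔓) (by rw [hideal]; rfl)
  haveI := Literature.AlgebraicGeometry.Resolution.isLocalization_atPrime_localization_quotient IL 𝔓 hI𝔓
  let θ₂ := (IsLocalization.algEquiv (𝔓.map (Ideal.Quotient.mk IL)).primeCompl
    (Localization.AtPrime (𝔓.map (Ideal.Quotient.mk IL)))
    (Localization.AtPrime 𝔓 ⧸ IL.map (algebraMap L (Localization.AtPrime 𝔓)))).toRingEquiv
  exact ⟨θ₁.trans θ₂.symm⟩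

/-- Hence `dim S_𝔔'/(x_I)S_𝔔' = dim (L/(x_I)L)_{𝔓̄}`. [folklore] -/
theorem ringKrullDim_stratum_eq {e : S} (I : Finset (Fin n))
    (L : Type u) [CommRing L] [Algebra S L] [IsLocalization (Submonoid.powers e) L]
    (𝔔' : Ideal S) [𝔔'.IsPrime] (he𝔔 : e ∉ 𝔔')
    [h𝔓 : (𝔔'.map (algebraMap S L)).IsPrime]
    (hI𝔓 : (Ideal.span (x '' (↑I : Set (Fin n)))).map (algebraMap S L) ≤ 𝔔'.map (algebraMap S L)) :
    haveI : ((𝔔'.map (algebraMap S L)).map (Ideal.Quotient.mk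
        ((Ideal.span (x '' (↑I : Set (Fin n)))).map (algebraMap S L)))).IsPrime :=
      Ideal.isPrime_map_quotientMk_of_isPrime hI𝔓
    ringKrullDim (Localization.AtPrime 𝔔' ⧸ (Ideal.span (x '' (↑I : Set (Fin n)))).map
        (algebraMap S (Localization.AtPrime 𝔔'))) =
      ringKrullDim (Localization.AtPrime ((𝔔'.map (algebraMap S L)).map (Ideal.Quotient.mk
        ((Ideal.span (x '' (↑I : Set (Fin n)))).map (algebraMap S L))))) := by
  obtain ⟨θ⟩ := nonempty_ringEquiv_stratum x I L 𝔔' he𝔔 hI𝔓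
  exact ringKrullDim_eq_of_ringEquiv θ

end Summit.ResolutionOfSingularities.ResolutionOfSingularities.Theorems.FRationalResolution.StratumModelInterfaces

end
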